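import Literature.AnabelianGeometry.SemiGraphs.TemperedPiDecomposition
import Literature.AnabelianGeometry.SemiGraphs.TemperedPiTreeCosetIso
import Literature.AnabelianGeometry.SemiGraphs.GaloisCoveringTorsor
import Literature.AnabelianGeometry.SemiGraphs.MorphismsOver
import HarnessLib

/-!
# Branch stabilisers at a tree vertex are conjugates of the branch subgroup ([SemiAnbd] Rmk 2.2.1, Thm 3.7 (iii))

Mochizuki, *Semi-graphs of anabelioids*, Publ. RIMS **42** (2006) [MochizukiSemiAnbd2006], Remark 2.2.1
p. 24 ("the image of each `Π_v` (respectively, `Π_b`) in `Π_𝒢` is equal to the stabilizer of a compatible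
system of vertices (respectively, edges) of this pro-semi-graph") and the proof of Theorem 3.7 (iii) p. 41
with the author's *Comments* (2020) item (6)(b) ("`H` … is … contained, for two distinct branches `b, b'`
abutting to `v` … in the intersection of the images of `π̂₁(𝒢_e)`, `π̂₁(𝒢_{e'})`, via `b, b'`").
[cite: MochizukiSemiAnbd2006, Rmk 2.2.1 p.24]

PROOF-ONLY file (abc-iut cell, FRONTIER programme REFUTE-F1732, brick R6c (c4); seat abc-iut-L3-t11
gen 3; no definitions, no named facts).  The ONE-LEVEL, FINITENESS-FREE «local branch-stabiliser
dictionary» at a tree vertex of a Galois tower `D : GaloisLevelData 𝒢` (abc-iut-L3-t9), in the currency of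
abc-iut-L3-t6's point sequences (`TemperedPiDecomposition.lean`): for a compatible point sequence `P` over
the vertex `w` with level-`n` tree vertex `ỹ := P.vertex n` of `𝔾̃_n = D.tree n`, and a branch `β` of
`𝔾̃_n` abutting to `ỹ` and lying over the branch `b` of `𝔾` (abutting to `w`):

* `PointSeq.exists_gal_conj_brHom_of_branchMap_eq` — if `g ∈ π₁^temp(𝒢)` fixes `β` at level `n`, then the
  level-`n` component of `g` is `σ_n^{f · b_*(k) · f⁻¹}` for SOME `f ∈ Π_w` and SOME `k ∈ Π_e` (`e` the
  edge of `b`): the stabiliser of a branch at `ỹ` over `b` lies in the image, under the decomposition map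
  `h ↦ σ_n^h` of `P`, of a `Π_w`-CONJUGATE of the branch subgroup `Π_b = b_*(Π_e)` (the conjugator `f`
  records WHICH lift of `b` at `ỹ` the branch `β` is; print's "well-defined up to conjugation", p. 23);
* `PointSeq.exists_gal_conj_brHom_of_edgeMap_eq` — the same with "fixes the edge of `β`" (an action over
  `𝔾` does not switch branches, p. 41);
* `PointSeq.gal_eq_gal_iff` — `σ_n^h = σ_n^{h'}` iff `h⁻¹ h'` fixes the point `P.pt n` (the local finite
  quotient `Π_w / Stab(P.pt n)` through which `Π_w` acts at level `n`);
* `PointSeq.exists_conj_brHom_pair_of_edgeMap_eq` — TWO fixed edges at `ỹ` over branches `b₁`, `b₂` of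
  `𝔾` at `w`: `f₁ b₁*(k₁) f₁⁻¹` and `f₂ b₂*(k₂) f₂⁻¹` have the same image in `Π_w / Stab(P.pt n)` and both
  map to the level-`n` component of `g` (the "fixed subjoint ⇒ intersection of two branch images"
  step of p. 41 / Comments (6)(b), at ONE finite level, for ANY countable `𝔾` and any Galois tower).

Everything is over abc-iut-L3-t11's one-level dictionary `GaloisCoveringTorsor.lean` (`CovObj.brOf`,
`exists_eq_brOf`, `abuts_brOf`, `branchMap_brOf`, `brOf_eq_brOf_iff`) read WITHOUT connectedness /
finiteness hypotheses, t6's rigidity characterisation `PointSeq.eq_gal`, and abc-iut-L3-d4's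
`treeIso_hom_comp_treeProj` / `orbitGraphMap_comp_treeIso` (`TemperedPiTreeCosetIso.lean`).  Consumer: abc-iut-L3-d4's
escape criterion (R6-level, (c5)) for the desk countermodel `𝒢_θ` of abc-iut-L3-d1 (memo
HOME/staging/L3/L3-d1/g3/COUNTERMODEL-Thm37iii-infinite.md) — towards a kernel erratum for the
∀-countable reading of [SemiAnbd] Thm 3.7 (iii) ([IUTchI] Rmk 2.5.3); print proves finite `𝔾` (kernel:
`compactInVerticialAt_of_finiteGraph`).  Nothing here bears on [IUTchIII] Cor. 3.12; typed ≠ proved.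
-/

namespace Literature.AnabelianGeometry.SemiGraphs

namespace ProfiniteSemiGraph

namespace GaloisLevelData

open CategoryTheory Topology
open Literature.AlgebraicGeometry.Frobenioids.QuasiTemperoid.BTempConnected (ρ_one_apply
  ρ_mul_apply ρ_inv_apply)

universe u

variable {𝒢 : ProfiniteSemiGraph.{u}} (D : GaloisLevelData 𝒢) (h𝒢 : 𝒢.IsCountable)

/-! ### The identification `𝔾_{𝒢_{∞,n}} ≅ 𝔾̃_n` on branches, projections and the action -/

/-- On branches: the base branch of `treeIso β₀` is the base branch `β₀.1.1` of `β₀`.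
[cite: MochizukiSemiAnbd2006, Prop 3.6 p.38] -/
theorem treeProj_branchMap_treeIso (n : ℕ) (β₀ : (D.cover h𝒢 n).orbitGraph.Branch) :
    (D.treeProj n).branchMap ((D.treeIso h𝒢 n).hom.branchMap β₀) = β₀.1.1 := by
  have h := congrArg SemiGraph.Hom.branchMap (D.treeIso_hom_comp_treeProj h𝒢 n)
  exact congrFun h β₀

/-- `treeIso.inv` then `treeIso.hom` is the identity on branches. [cite: MochizukiSemiAnbd2006, Prop 3.6 p.38] -/
theorem treeIso_hom_branchMap_inv (n : ℕ) (β : (D.tree n).Branch) :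
    (D.treeIso h𝒢 n).hom.branchMap ((D.treeIso h𝒢 n).inv.branchMap β) = β := by
  have h := congrArg SemiGraph.Hom.branchMap (D.treeIso h𝒢 n).inv_hom_id
  exact congrFun h β

/-- `treeIso.hom` then `treeIso.inv` is the identity on branches. [cite: MochizukiSemiAnbd2006, Prop 3.6 p.38] -/
theorem treeIso_inv_branchMap_hom (n : ℕ) (β₀ : (D.cover h𝒢 n).orbitGraph.Branch) :
    (D.treeIso h𝒢 n).inv.branchMap ((D.treeIso h𝒢 n).hom.branchMap β₀) = β₀ := by
  have h := congrArg SemiGraph.Hom.branchMap (D.treeIso h𝒢 n).hom_inv_id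
  exact congrFun h β₀

/-- `treeIso.hom` then `treeIso.inv` is the identity on vertices. [cite: MochizukiSemiAnbd2006, Prop 3.6 p.38] -/
theorem treeIso_inv_vertexMap_hom (n : ℕ) (V : (D.cover h𝒢 n).orbitGraph.Vertex) :
    (D.treeIso h𝒢 n).inv.vertexMap ((D.treeIso h𝒢 n).hom.vertexMap V) = V := by
  have h := congrArg SemiGraph.Hom.vertexMap (D.treeIso h𝒢 n).hom_inv_id
  exact congrFun h V

/-- The identification reflects abutment: if `treeIso β₀` abuts to `treeIso V` in `𝔾̃_n` then `β₀` abuts to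
`V` in the underlying semi-graph of `𝒢_{∞,n}`. [cite: MochizukiSemiAnbd2006, Prop 3.6 p.38] -/
theorem orbitGraph_abuts_of_tree_abuts (n : ℕ) (β₀ : (D.cover h𝒢 n).orbitGraph.Branch)
    (V : (D.cover h𝒢 n).orbitGraph.Vertex)
    (h : (D.tree n).abuts ((D.treeIso h𝒢 n).hom.branchMap β₀) = some ((D.treeIso h𝒢 n).hom.vertexMap V)) :
    (D.cover h𝒢 n).orbitGraph.abuts β₀ = some V := by
  have h' := (D.treeIso h𝒢 n).inv.abuts_branchMap _ _ h
  rw [D.treeIso_inv_branchMap_hom h𝒢, D.treeIso_inv_vertexMap_hom h𝒢] at h'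
  exact h'

/-- The action of `σ ∈ Aut(𝒢_{∞,n})` on the branches of `𝔾̃_n`, read through the identification:
`σ · treeIso β₀ = treeIso (σ · β₀)`. [cite: MochizukiSemiAnbd2006, Thm 3.7(iii) p.41] -/
theorem galTreeAct_branchMap_treeIso (n : ℕ) (σ : D.Gal h𝒢 n) (β₀ : (D.cover h𝒢 n).orbitGraph.Branch) :
    (D.galTreeAct h𝒢 n σ).hom.branchMap ((D.treeIso h𝒢 n).hom.branchMap β₀) =
      (D.treeIso h𝒢 n).hom.branchMap ((CovObj.orbitGraphMap σ.hom).branchMap β₀) := by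
  have h := congrArg SemiGraph.Hom.branchMap (D.orbitGraphMap_comp_treeIso h𝒢 n σ)
  exact (congrFun h β₀).symm

namespace PointSeq

variable {D h𝒢} {w : 𝒢.graph.Vertex} (P : D.PointSeq h𝒢 w)

/-! ### The local quotient `Π_w / Stab(P.pt n)` -/

/-- **`σ_n^h = σ_n^{h'}` iff `h⁻¹ h'` fixes the point `P.pt n`**: the decomposition map at level `n`
factors through the finite quotient of `Π_w` by the (open) stabiliser of the point.
[cite: MochizukiSemiAnbd2006, Thm 3.7(i) p.40] -/
theorem gal_eq_gal_iff (n : ℕ) (h h' : 𝒢.Gv w) :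
    P.gal n h = P.gal n h' ↔ ((D.cover h𝒢 n).SV w).obj.ρ (h⁻¹ * h') (P.pt n) = P.pt n := by
  have key : ((D.proj h𝒢 n).comp P.decompHom) (h⁻¹ * h') = 1 ↔
      ((D.cover h𝒢 n).SV w).obj.ρ (h⁻¹ * h') (P.pt n) = P.pt n := P.gal_eq_one_iff n (h⁻¹ * h')
  rw [map_mul, map_inv, inv_mul_eq_one] at key
  exact key

/-! ### Branch stabilisers at `P.vertex n` (cover coordinates) -/

/-- Cover-coordinate form.  If `σ ∈ Aut(𝒢_{∞,n})` fixes a branch `β₀` of the underlying semi-graph of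
`𝒢_{∞,n}` lying over the branch `b` of `𝔾` (abutting to `w`) and abutting to the orbit of `P.pt n`, then
`σ = σ_n^{f · b_*(k) · f⁻¹}` for some `f ∈ Π_w`, `k ∈ Π_e`. [cite: MochizukiSemiAnbd2006, Rmk 2.2.1 p.24] -/
theorem exists_gal_conj_brHom_of_orbitGraphMap_branchMap_eq (n : ℕ) (σ : D.Gal h𝒢 n)
    (b : 𝒢.graph.Branch) (hb : 𝒢.graph.abuts b = some w)
    (β₀ : (D.cover h𝒢 n).orbitGraph.Branch) (hβ₀b : β₀.1.1 = b)
    (hβ₀ : (D.cover h𝒢 n).orbitGraph.abuts β₀ = some (Quot.mk _ ⟨w, P.pt n⟩))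
    (hfix : (CovObj.orbitGraphMap σ.hom).branchMap β₀ = β₀) :
    ∃ (f : 𝒢.Gv w) (k : 𝒢.Ge (𝒢.graph.edgeOf b)),
      σ = P.gal n (f * 𝒢.brHom b w hb k * f⁻¹) := by
  -- `β₀ = brOf b y` for a point `y ∈ (𝒢_{∞,n})_w`
  obtain ⟨y, rfl⟩ := (D.cover h𝒢 n).exists_eq_brOf b hb β₀ hβ₀b
  -- `brOf b y` abuts to the orbit of `y`, hence `y = g · P.pt n`
  rw [(D.cover h𝒢 n).abuts_brOf b hb y] at hβ₀
  obtain ⟨g, hg⟩ := (D.cover h𝒢 n).exists_ρ_of_mk_eq_mk (Option.some.inj hβ₀).symm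
  -- `σ · brOf b y = brOf b (σ y)`, so `σ y = k · y` with `k ∈ Π_b`
  rw [(D.cover h𝒢 n).branchMap_brOf b hb σ y, (D.cover h𝒢 n).brOf_eq_brOf_iff b hb] at hfix
  obtain ⟨k', ⟨k, rfl⟩, hk⟩ := hfix
  have hk' : (𝒢.brHom b w hb).toMonoidHom k = 𝒢.brHom b w hb k := rfl
  rw [hk'] at hk
  refine ⟨g⁻¹, k, ?_⟩
  apply P.eq_gal
  -- `σ y = b_*(k)⁻¹ · y` with `y = g · P.pt n`, hence `σ (P.pt n) = (g⁻¹ b_*(k)⁻¹ g) · P.pt n`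
  have h1 : (σ.hom.fV w).hom.hom y = ((D.cover h𝒢 n).SV w).obj.ρ (𝒢.brHom b w hb k)⁻¹ y := by
    have h2 := congrArg (((D.cover h𝒢 n).SV w).obj.ρ (𝒢.brHom b w hb k)⁻¹) hk
    rw [← ρ_mul_apply, inv_mul_cancel, ρ_one_apply] at h2
    exact h2
  rw [← hg] at h1
  rw [CovHom.fV_ρ] at h1
  -- `h1 : g · σ (P.pt n) = b_*(k)⁻¹ · g · P.pt n`
  have h3 := congrArg (((D.cover h𝒢 n).SV w).obj.ρ g⁻¹) h1
  rw [← ρ_mul_apply, inv_mul_cancel, ρ_one_apply, ← ρ_mul_apply, ← ρ_mul_apply] at h3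
  rw [h3]
  have h4 : (g⁻¹ * 𝒢.brHom b w hb k * g⁻¹⁻¹)⁻¹ = g⁻¹ * (𝒢.brHom b w hb k)⁻¹ * g := by group
  rw [h4]

/-! ### Branch stabilisers at `P.vertex n` (tree coordinates) -/

/-- **Local branch-stabiliser lemma** ([SemiAnbd] Rmk 2.2.1 at one level of a Galois tower, no
finiteness): if `g ∈ π₁^temp(𝒢)` fixes, at level `n`, a branch `β` of the tree `𝔾̃_n` abutting to the vertex
`P.vertex n` of the point sequence `P` over `w` and lying over the branch `b` of `𝔾` (abutting to `w`),
then the level-`n` component of `g` is `σ_n^{f · b_*(k) · f⁻¹}` for some `f ∈ Π_w`, `k ∈ Π_e` — i.e. it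
lies in the image under the decomposition map of a `Π_w`-conjugate of the branch subgroup `Π_b`.
[cite: MochizukiSemiAnbd2006, Rmk 2.2.1 p.24] -/
theorem exists_gal_conj_brHom_of_branchMap_eq (n : ℕ) (g : D.temperedPi h𝒢)
    (b : 𝒢.graph.Branch) (hb : 𝒢.graph.abuts b = some w)
    (β : (D.tree n).Branch) (hβb : (D.treeProj n).branchMap β = b)
    (hβ : (D.tree n).abuts β = some (P.vertex n))
    (hfix : (D.treeAct h𝒢 n g).hom.branchMap β = β) :
    ∃ (f : 𝒢.Gv w) (k : 𝒢.Ge (𝒢.graph.edgeOf b)),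
      D.proj h𝒢 n g = P.gal n (f * 𝒢.brHom b w hb k * f⁻¹) := by
  set β₀ := (D.treeIso h𝒢 n).inv.branchMap β with hβ₀
  have hβeq : β = (D.treeIso h𝒢 n).hom.branchMap β₀ := (D.treeIso_hom_branchMap_inv h𝒢 n β).symm
  refine P.exists_gal_conj_brHom_of_orbitGraphMap_branchMap_eq n (D.proj h𝒢 n g) b hb β₀ ?_ ?_ ?_
  · rw [← hβb, hβeq, D.treeProj_branchMap_treeIso h𝒢]
  · apply D.orbitGraph_abuts_of_tree_abuts h𝒢
    rw [← hβeq]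
    exact hβ
  · have h1 := hfix
    rw [D.treeAct_apply, hβeq, D.galTreeAct_branchMap_treeIso h𝒢] at h1
    have h2 := congrArg (D.treeIso h𝒢 n).inv.branchMap h1
    rw [D.treeIso_inv_branchMap_hom h𝒢, D.treeIso_inv_branchMap_hom h𝒢] at h2
    exact h2

/-- The same with the hypothesis "`g` fixes the EDGE of `β`" (an action over `𝔾` does not switch the
branches of a fixed edge, p. 41). [cite: MochizukiSemiAnbd2006, Thm 3.7(iii) p.41] -/
theorem exists_gal_conj_brHom_of_edgeMap_eq (n : ℕ) (g : D.temperedPi h𝒢)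
    (b : 𝒢.graph.Branch) (hb : 𝒢.graph.abuts b = some w)
    (β : (D.tree n).Branch) (hβb : (D.treeProj n).branchMap β = b)
    (hβ : (D.tree n).abuts β = some (P.vertex n))
    (hfix : (D.treeAct h𝒢 n g).hom.edgeMap ((D.tree n).edgeOf β) = (D.tree n).edgeOf β) :
    ∃ (f : 𝒢.Gv w) (k : 𝒢.Ge (𝒢.graph.edgeOf b)),
      D.proj h𝒢 n g = P.gal n (f * 𝒢.brHom b w hb k * f⁻¹) :=
  P.exists_gal_conj_brHom_of_branchMap_eq n g b hb β hβb hβ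
    (SemiGraph.branchMap_eq_of_over_aut (D.treeProj n) (D.treeAct h𝒢 n g) (D.treeAct_over h𝒢 n g) β hfix)

/-- In decomposition-homomorphism form: the level-`n` components of `g` and of
`decompHom (f · b_*(k) · f⁻¹)` agree. [cite: MochizukiSemiAnbd2006, Rmk 2.2.1 p.24] -/
theorem exists_proj_eq_proj_decompHom_conj_brHom (n : ℕ) (g : D.temperedPi h𝒢)
    (b : 𝒢.graph.Branch) (hb : 𝒢.graph.abuts b = some w)
    (β : (D.tree n).Branch) (hβb : (D.treeProj n).branchMap β = b)
    (hβ : (D.tree n).abuts β = some (P.vertex n))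
    (hfix : (D.treeAct h𝒢 n g).hom.edgeMap ((D.tree n).edgeOf β) = (D.tree n).edgeOf β) :
    ∃ (f : 𝒢.Gv w) (k : 𝒢.Ge (𝒢.graph.edgeOf b)),
      D.proj h𝒢 n g = D.proj h𝒢 n (P.decompHom (f * 𝒢.brHom b w hb k * f⁻¹)) :=
  P.exists_gal_conj_brHom_of_edgeMap_eq n g b hb β hβb hβ hfix

/-! ### Two fixed edges at one vertex: the intersection of two branch images at one level -/

/-- **Fixed subjoint at `P.vertex n` ⇒ the level-`n` component of `g` lies in BOTH conjugate branch
images** (proof of Thm 3.7 (iii), third paragraph / Comments (6)(b), at one finite level, for any countable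
`𝔾`): if `g` fixes the edges of two branches `β₁`, `β₂` of `𝔾̃_n` abutting to `P.vertex n`, over the branches
`b₁`, `b₂` of `𝔾` at `w`, then for some `f₁, f₂ ∈ Π_w`, `k₁ ∈ Π_{e₁}`, `k₂ ∈ Π_{e₂}` the elements
`h₁ = f₁ b₁*(k₁) f₁⁻¹` and `h₂ = f₂ b₂*(k₂) f₂⁻¹` both have level-`n` component that of `g`, and
`h₁⁻¹ h₂` fixes the point `P.pt n` (they agree in the local quotient `Π_w / Stab(P.pt n)`).
[cite: MochizukiSemiAnbd2006, Thm 3.7(iii) p.41] -/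
theorem exists_conj_brHom_pair_of_edgeMap_eq (n : ℕ) (g : D.temperedPi h𝒢)
    (b₁ b₂ : 𝒢.graph.Branch) (hb₁ : 𝒢.graph.abuts b₁ = some w) (hb₂ : 𝒢.graph.abuts b₂ = some w)
    (β₁ β₂ : (D.tree n).Branch) (hβ₁b : (D.treeProj n).branchMap β₁ = b₁)
    (hβ₂b : (D.treeProj n).branchMap β₂ = b₂)
    (hβ₁ : (D.tree n).abuts β₁ = some (P.vertex n)) (hβ₂ : (D.tree n).abuts β₂ = some (P.vertex n))
    (hfix₁ : (D.treeAct h𝒢 n g).hom.edgeMap ((D.tree n).edgeOf β₁) = (D.tree n).edgeOf β₁)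
    (hfix₂ : (D.treeAct h𝒢 n g).hom.edgeMap ((D.tree n).edgeOf β₂) = (D.tree n).edgeOf β₂) :
    ∃ (f₁ f₂ : 𝒢.Gv w) (k₁ : 𝒢.Ge (𝒢.graph.edgeOf b₁)) (k₂ : 𝒢.Ge (𝒢.graph.edgeOf b₂)),
      D.proj h𝒢 n g = P.gal n (f₁ * 𝒢.brHom b₁ w hb₁ k₁ * f₁⁻¹) ∧
      D.proj h𝒢 n g = P.gal n (f₂ * 𝒢.brHom b₂ w hb₂ k₂ * f₂⁻¹) ∧
      ((D.cover h𝒢 n).SV w).obj.ρ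
        ((f₁ * 𝒢.brHom b₁ w hb₁ k₁ * f₁⁻¹)⁻¹ * (f₂ * 𝒢.brHom b₂ w hb₂ k₂ * f₂⁻¹)) (P.pt n) = P.pt n := by
  obtain ⟨f₁, k₁, h₁⟩ := P.exists_gal_conj_brHom_of_edgeMap_eq n g b₁ hb₁ β₁ hβ₁b hβ₁ hfix₁
  obtain ⟨f₂, k₂, h₂⟩ := P.exists_gal_conj_brHom_of_edgeMap_eq n g b₂ hb₂ β₂ hβ₂b hβ₂ hfix₂
  exact ⟨f₁, f₂, k₁, k₂, h₁, h₂, (P.gal_eq_gal_iff n _ _).mp (h₁.symm.trans h₂)⟩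

end PointSeq

end GaloisLevelData

end ProfiniteSemiGraph

end Literature.AnabelianGeometry.SemiGraphs
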